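import Literature.MathematicalPhysics.QuantumLattice.EmeryThreeBandStatesNonempty
import Literature.MathematicalPhysics.QuantumLattice.PeriodicTrialState
import HarnessLib

/-!
# The periodic CLUSTER TRIAL STATE over an ALIGNED RECTANGLE: the superlattice average of `⊗_v ρ₀` (one even density matrix on a block of
# `Π_i (m_i+1)` cells of a `q`-periodic model) is `q`-periodic, with EXACT cell energy `|block|⁻¹(Re tr(H_block ρ₀) − Re Ψ∅)` and filling `|block|⁻¹ Re tr(N ρ₀)`

Topic `Literature/MathematicalPhysics/QuantumLattice` (family `hubbard`, model-free, general `d`). Written for stage S2 (CERTIFIER-FAMILIES) of the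
Hubbard material-oracle programme, item (iv) «multi-band» (crew hubbard-fast, seat hubbard-box-p1): the CAP half of a two-sided energy window for a
SUPERLATTICE-PERIODIC model (decorated / three-band Emery `CuO₂`, staggered, strained cells) needs a trial state IN THE PERIODIC VARIATIONAL CLASS
whose cell energy is an exactly computable cluster number. `PeriodicTrialState` (this seat) does it for CUBIC aligned boxes `[0,N)^d` with a collar
error term; `FermionRectTilingProductState` / `ClusterProductStateEnergy` (hubbard-box-p3) give the rectangular tiling state `⊗_v ρ₀` over
`ℓ_Q(v) + [0,Q+1)` and its exact energy when the straddling terms vanish — but that state is only `Q`-periodic. Here the two are combined: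

* §1 ALIGNED RECTANGLES: `alignedPeriods q m = ((q_i+1)(m_i+1) − 1)_i` (the block `[0,Q+1) = Π_i [0,(q_i+1)(m_i+1))` is `Π_i (m_i+1)` cells of
  the `q`-superlattice — no divisibility hypothesis, alignment is built in), the superlattice points `latPt q m k = ℓ_q(pos k)`, `k ∈ Cell m`,
  the decomposition `Cell q × Cell m ≃ [0,Q+1)` (`cellLatRectEquiv`, `x = pos c + ℓ_q(pos k)`), `sum_halfOpenRect_aligned_eq_sum_sum`,
  `card_cell_alignedPeriods`.
* §2 **`perRectTrialState q m ρ₀ … := (rectTilingState (alignedPeriods q m) ρ₀ …).shiftAverage (latPt q m)`** — `q`-PERIODIC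
  (`perRectTrialState_isPeriodic`: a period vector of `q` rotates the superlattice points of the block, the wrap-around absorbed by the
  `L_Q`-periodicity of the tiling state).
* §3 EXACT BOOKKEEPING: one-site densities `(ω̃ ∘ τ_x).density = |Cell m|⁻¹ Σ_k ρ((⊗ρ₀) ∘ τ_{x + ℓ_q(pos k)})` and, for `x` in the `q`-cell, as traces
  `|Cell m|⁻¹ Σ_k Re tr((n_{y↑}+n_{y↓})ρ₀)`, `y = x + ℓ_q(pos k)` (`density_shift_perRectTrialState_eq_trace`); the CELL FILLING
  **`cellFilling q ω̃ = |Cell Q|⁻¹ Re tr(N ρ₀)`**; the cell mean energy of a `q`-periodic `Ψ`: `|Cell Q| ē_q(ω̃) = Σ_{x ∈ [0,Q+1)} Re ε_{⊗ρ₀}(x)`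
  and, when the straddling terms of `Ψ` vanish in `⊗ρ₀` (hopping-type interactions), **`ē_q(ω̃) = |Cell Q|⁻¹ (Re tr(H_{[0,Q+1)} ρ₀) − Re (⊗ρ₀)(Ψ∅))`**
  (`cellMeanEnergy_perRectTrialState_eq`).

Everything is PROVED (0 sorry); definitions with bodies: `alignedPeriods`, `latPt`, `cellLatRectEquiv`, `perRectTrialState`. HONEST SCOPE: bookkeeping
of a product trial state; no energy is computed and no model is instantiated here (the Emery instance is the sequel `EmeryThreeBandClusterTrialCap`).

## Tree / Mathlib search

REUSED: `rectTilingState`, `rectTilingState_isPeriodic`, `halfOpenRect`, `mem_halfOpenRect`, `card_halfOpenRect` (`FermionRectTilingProductState`);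
`sum_cell_eq_sum_halfOpenRect`, `sum_cell_siteEnergy_rectTilingState_eq`, `sum_cell_density_rectTilingState_eq` (`ClusterProductStateEnergy`);
`density_shift_rectTilingState_eq_trace` (`EmeryThreeBandStatesNonempty`); `siteEnergy_shiftAverage`, `IsPeriodic.siteEnergy_shift_superlatVec`,
the cubic `cellLatEquiv` / `perTrialState_isPeriodic` pattern (`PeriodicTrialState`); `shiftAverage(_expect)`, `shift_shiftAverage`, `density_shiftAverage`,
`cellRotate`, `cellPos_cellRotate_add`, `IsPeriodic.shift_add_periodVec`, `Cell`, `cellPos`, `cellFilling` (`PeriodicStatesCellAverage`,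
`SuperlatticeCellEnergyFamilies`); `superlatVec(_apply/_add/_zero)`, `periodVec`, `cellRes`, `eq_cellPos_cellRes_add_superlatVec`, `cellMeanEnergy`, `siteEnergy`
(`PeriodicInteractionsCellEnergy`). `rg 'alignedPeriods|perRectTrial|latPt'` (QuantumLattice, 2026-08-28): nothing.

## References

* O. Bratteli, D. W. Robinson, *OAQSM 2* (1997), Thm. 6.2.40 (periodic product trial states). [cite: BratteliRobinsonII1997, Thm. 6.2.40]
* H. Araki, H. Moriya, Rev. Math. Phys. 15 (2003) 93, §4.1 Def. 4.3/4.5, §11.1 Thm. 11.2. [cite: ArakiMoriya2003, §11.1 Theorem 11.2]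
* D. Ruelle, *Statistical Mechanics: Rigorous Results* (1969), §3.3 (cluster trial states). [cite: Ruelle1969, §3.3]
-/

noncomputable section

open scoped ComplexOrder BigOperators
open Finset

namespace Literature.MathematicalPhysics.QuantumLattice

open Matrix HubbardWave0 Literature.Probability.LatticeModels ThermodynamicLimit

namespace InfVolFermionState

variable {d : ℕ}

/-! ### §1. Aligned rectangles and their superlattice points -/

/-- **The periods of the aligned rectangle**: `Q_i = (q_i+1)(m_i+1) − 1`, so that the block `[0,Q+1)` is `Π_i (m_i+1)` cells of the `q`-superlattice.
[cite: ArakiMoriya2003, §4.1 Def. 4.3] -/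
def alignedPeriods (q m : Fin d → ℕ) : Fin d → ℕ := fun i => (q i + 1) * (m i + 1) - 1

/-- `Q_i + 1 = (q_i+1)(m_i+1)`. [cite: ArakiMoriya2003, §4.1 Def. 4.3] -/
theorem alignedPeriods_add_one (q m : Fin d → ℕ) (i : Fin d) : alignedPeriods q m i + 1 = (q i + 1) * (m i + 1) :=
  Nat.sub_add_cancel (Nat.one_le_iff_ne_zero.2 (Nat.mul_ne_zero (Nat.succ_ne_zero _) (Nat.succ_ne_zero _)))

/-- `Q_i + 1 = (q_i+1)(m_i+1)` over `ℤ`. [cite: ArakiMoriya2003, §4.1 Def. 4.3] -/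
theorem alignedPeriods_add_one_int (q m : Fin d → ℕ) (i : Fin d) :
    ((alignedPeriods q m i : ℕ) : ℤ) + 1 = ((q i : ℤ) + 1) * ((m i : ℤ) + 1) := by
  exact_mod_cast alignedPeriods_add_one q m i

/-- `(q_i+1) ∣ (Q_i+1)`. [cite: ArakiMoriya2003, §4.1 Def. 4.3] -/
theorem dvd_alignedPeriods_add_one (q m : Fin d → ℕ) (i : Fin d) : (q i + 1) ∣ (alignedPeriods q m i + 1) :=
  ⟨m i + 1, alignedPeriods_add_one q m i⟩

/-- **The superlattice points of the block**: `ℓ_q(pos k) = ((q_i+1) k_i)_i`, `k ∈ Cell m`. [cite: ArakiMoriya2003, §4.1 Def. 4.3] -/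
def latPt (q m : Fin d → ℕ) (k : Cell m) : Site d := superlatVec q (cellPos k)

/-- Coordinates of a superlattice point. [cite: ArakiMoriya2003, §4.1 Def. 4.3] -/
theorem latPt_apply (q m : Fin d → ℕ) (k : Cell m) (i : Fin d) : latPt q m k i = ((k i : ℕ) : ℤ) * ((q i : ℤ) + 1) := rfl

/-- A cell point plus a superlattice point of the block lies in the block. [cite: ArakiMoriya2003, §4.1 Def. 4.3] -/
theorem cellPos_add_latPt_mem_halfOpenRect (q m : Fin d → ℕ) (c : Cell q) (k : Cell m) :
    cellPos c + latPt q m k ∈ halfOpenRect (alignedPeriods q m) := by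
  rw [mem_halfOpenRect]
  intro i
  have hc : ((c i : ℕ) : ℤ) ≤ q i := by exact_mod_cast Nat.lt_succ_iff.1 (c i).isLt
  have hk : ((k i : ℕ) : ℤ) ≤ m i := by exact_mod_cast Nat.lt_succ_iff.1 (k i).isLt
  rw [alignedPeriods_add_one_int]
  simp only [Pi.add_apply, cellPos, latPt_apply]
  constructor
  · positivity
  · nlinarith [Int.natCast_nonneg (q i), Int.natCast_nonneg (k i : ℕ), Int.natCast_nonneg (c i : ℕ), Int.natCast_nonneg (m i)]

/-- The superlattice points lie in the block. [cite: ArakiMoriya2003, §4.1 Def. 4.3] -/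
theorem latPt_mem_halfOpenRect (q m : Fin d → ℕ) (k : Cell m) : latPt q m k ∈ halfOpenRect (alignedPeriods q m) := by
  have h := cellPos_add_latPt_mem_halfOpenRect q m (fun i => (0 : Fin (q i + 1))) k
  have h0 : cellPos (fun i => (0 : Fin (q i + 1)) : Cell q) = 0 := by funext i; simp [cellPos]
  rwa [h0, zero_add] at h

/-- **`Cell q × Cell m ≃ [0,Q+1)`**, `(c, k) ↦ pos c + ℓ_q(pos k)`: every site of the aligned block is uniquely a cell point plus a superlattice point.
[cite: ArakiMoriya2003, §4.1 Def. 4.3] -/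
def cellLatRectEquiv (q m : Fin d → ℕ) : Cell q × Cell m ≃ ↥(halfOpenRect (alignedPeriods q m)) where
  toFun p := ⟨cellPos p.1 + latPt q m p.2, cellPos_add_latPt_mem_halfOpenRect q m p.1 p.2⟩
  invFun x := (cellRes q x.1, fun i => ⟨(x.1 i / ((q i : ℤ) + 1)).toNat, by
    have hx := (mem_halfOpenRect.1 x.2) i
    rw [alignedPeriods_add_one_int] at hx
    have h0 : (0 : ℤ) < (q i : ℤ) + 1 := by positivity
    have hdiv : 0 ≤ x.1 i / ((q i : ℤ) + 1) := Int.ediv_nonneg hx.1 h0.le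
    have hlt : x.1 i / ((q i : ℤ) + 1) < (m i : ℤ) + 1 := (Int.ediv_lt_iff_lt_mul h0).2 (by rw [mul_comm]; linarith [hx.2])
    omega⟩)
  left_inv p := by
    obtain ⟨c, k⟩ := p
    have hc : ∀ i, ((c i : ℕ) : ℤ) < (q i : ℤ) + 1 := fun i => by exact_mod_cast (c i).isLt
    have hres : cellRes q (cellPos c + latPt q m k) = c := by
      funext i
      apply Fin.ext
      simp only [cellRes, Pi.add_apply, cellPos, latPt_apply]
      rw [Int.add_mul_emod_self_right, Int.emod_eq_of_lt (by positivity) (hc i), Int.toNat_natCast]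
    refine Prod.ext hres (funext fun i => Fin.ext ?_)
    have h0 : (0 : ℤ) < (q i : ℤ) + 1 := by positivity
    simp only [Pi.add_apply, cellPos, latPt_apply]
    rw [Int.add_mul_ediv_right _ _ h0.ne', Int.ediv_eq_zero_of_lt (by positivity) (hc i), zero_add, Int.toNat_natCast]
  right_inv x := by
    apply Subtype.ext
    have h := eq_cellPos_cellRes_add_superlatVec q x.1
    show cellPos (cellRes q x.1) + latPt q m _ = x.1
    conv_rhs => rw [h]
    congr 1
    funext i
    simp only [latPt_apply, superlatVec_apply]
    have hx := (mem_halfOpenRect.1 x.2) i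
    have h0 : (0 : ℤ) < (q i : ℤ) + 1 := by positivity
    rw [Int.toNat_of_nonneg (Int.ediv_nonneg hx.1 h0.le)]

/-- **Sums over an aligned block split over cell points and superlattice points**: `Σ_{x ∈ [0,Q+1)} f x = Σ_c Σ_k f(pos c + ℓ_q(pos k))`.
[cite: ArakiMoriya2003, §4.1 Def. 4.3] -/
theorem sum_halfOpenRect_aligned_eq_sum_sum {α : Type*} [AddCommMonoid α] (q m : Fin d → ℕ) (f : Site d → α) :
    ∑ x ∈ halfOpenRect (alignedPeriods q m), f x = ∑ c : Cell q, ∑ k : Cell m, f (cellPos c + latPt q m k) := by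
  rw [← Finset.sum_coe_sort (halfOpenRect (alignedPeriods q m)), ← Fintype.sum_prod_type', ← (cellLatRectEquiv q m).sum_comp]
  rfl

/-- `|Cell Q| = |Cell q| · |Cell m|`. [cite: ArakiMoriya2003, §4.1 Def. 4.3] -/
theorem card_cell_alignedPeriods (q m : Fin d → ℕ) :
    Fintype.card (Cell (alignedPeriods q m)) = Fintype.card (Cell q) * Fintype.card (Cell m) := by
  rw [Fintype.card_pi, Fintype.card_pi, Fintype.card_pi, ← Finset.prod_mul_distrib]
  refine Finset.prod_congr rfl fun i _ => ?_
  rw [Fintype.card_fin, Fintype.card_fin, Fintype.card_fin, alignedPeriods_add_one]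

/-- `|Cell Q| = #[0,Q+1)`. [cite: ArakiMoriya2003, §4.1 Def. 4.3] -/
theorem card_cell_eq_card_halfOpenRect (Q : Fin d → ℕ) : Fintype.card (Cell Q) = #(halfOpenRect Q) := by
  rw [card_halfOpenRect, Fintype.card_pi]
  exact Finset.prod_congr rfl fun i _ => Fintype.card_fin _

/-- `ℓ_q` of a period vector of `Cell m` is the period vector of the block. [cite: ArakiMoriya2003, §4.1 Def. 4.3] -/
theorem superlatVec_periodVec_cell (q m : Fin d → ℕ) (i : Fin d) :
    superlatVec q (periodVec m i) = periodVec (alignedPeriods q m) i := by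
  funext j
  rw [superlatVec_apply, periodVec, periodVec]
  by_cases hj : j = i
  · subst hj
    rw [Pi.single_eq_same, Pi.single_eq_same, alignedPeriods_add_one_int, mul_comm]
  · rw [Pi.single_eq_of_ne hj, Pi.single_eq_of_ne hj, zero_mul]

/-! ### §2. The periodic cluster trial state over an aligned rectangle -/

section Trial

variable (q m : Fin d → ℕ) (ρ₀ : FermionOp (halfOpenRect (alignedPeriods q m))) (hev : parityAut ρ₀ = ρ₀) (hpsd : ρ₀.PosSemidef)
  (htr : ρ₀.trace = 1)

/-- **THE PERIODIC CLUSTER TRIAL STATE over the aligned block**: the average of the rectangular tiling state `⊗_v ρ₀` over the superlattice points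
`ℓ_q(pos k)`, `k ∈ Cell m`, of the block. [cite: BratteliRobinsonII1997, Thm. 6.2.40] -/
def perRectTrialState : InfVolFermionState d :=
  (rectTilingState (alignedPeriods q m) ρ₀ hev hpsd htr).shiftAverage (latPt q m)

/-- Unfolding. [cite: BratteliRobinsonII1997, Thm. 6.2.40] -/
theorem perRectTrialState_def :
    perRectTrialState q m ρ₀ hev hpsd htr = (rectTilingState (alignedPeriods q m) ρ₀ hev hpsd htr).shiftAverage (latPt q m) := rfl

/-- **THE PERIODIC CLUSTER TRIAL STATE IS `q`-PERIODIC** (a period vector of `q` rotates the superlattice points of the block; the wrap-around is a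
period of the tiling state). [cite: BratteliRobinsonII1997, Thm. 6.2.40] [cite: ArakiMoriya2003, §4.1 Def. 4.5] -/
theorem perRectTrialState_isPeriodic : (perRectTrialState q m ρ₀ hev hpsd htr).IsPeriodic q := by
  intro i
  set ν := rectTilingState (alignedPeriods q m) ρ₀ hev hpsd htr with hν
  have hνper : ν.IsPeriodic (alignedPeriods q m) := rectTilingState_isPeriodic _ ρ₀ hev hpsd htr
  rw [perRectTrialState_def, ← hν, shift_shiftAverage]
  refine InfVolFermionState.ext fun Λ => LinearMap.ext fun A => ?_
  rw [shiftAverage_expect, shiftAverage_expect]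
  refine congrArg _ ?_
  have hterm : ∀ k : Cell m, ((ν.shift (periodVec q i)).shift (latPt q m k)).expect Λ A =
      (ν.shift (latPt q m (cellRotate m i k))).expect Λ A := by
    intro k
    rw [shift_shift]
    have hrot := cellPos_cellRotate_add m i k
    have h2 : latPt q m (cellRotate m i k) + (if k i = Fin.last (m i) then periodVec (alignedPeriods q m) i else 0) =
        latPt q m k + periodVec q i := by
      have h3 := congrArg (superlatVec q) hrot
      rw [superlatVec_add, superlatVec_add, superlatVec_unitVec] at h3
      rw [latPt, latPt, ← h3]
      congr 1
      by_cases hl : k i = Fin.last (m i)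
      · rw [if_pos hl, if_pos hl, superlatVec_periodVec_cell]
      · rw [if_neg hl, if_neg hl, superlatVec_zero]
    rw [← h2]
    by_cases hl : k i = Fin.last (m i)
    · rw [if_pos hl, hνper.shift_add_periodVec]
    · rw [if_neg hl, add_zero]
  simp only [hterm]
  exact (cellRotate m i).sum_comp (fun k => (ν.shift (latPt q m k)).expect Λ A)

/-! ### §3. Exact bookkeeping: one-site densities, cell filling, cell mean energy -/

/-- **Translated one-site densities of the trial state**: `ρ(ω̃ ∘ τ_x) = |Cell m|⁻¹ Σ_k ρ((⊗ρ₀) ∘ τ_{x + ℓ_q(pos k)})`. [cite: ArakiMoriya2003, §4.1] -/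
theorem density_shift_perRectTrialState (x : Site d) :
    ((perRectTrialState q m ρ₀ hev hpsd htr).shift x).density =
      (Fintype.card (Cell m) : ℝ)⁻¹ * ∑ k : Cell m, ((rectTilingState (alignedPeriods q m) ρ₀ hev hpsd htr).shift (x + latPt q m k)).density := by
  rw [perRectTrialState_def, shift_shiftAverage, density_shiftAverage]
  simp only [shift_shift, add_comm (latPt q m _) x]

/-- **… as traces, for a point of the `q`-cell**: `ρ(ω̃ ∘ τ_{pos c}) = |Cell m|⁻¹ Σ_k Re tr((n_{y↑}+n_{y↓}) ρ₀)`, `y = pos c + ℓ_q(pos k)`.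
[cite: BratteliRobinsonII1997, Thm. 6.2.40] -/
theorem density_shift_perRectTrialState_eq_trace (c : Cell q) :
    ((perRectTrialState q m ρ₀ hev hpsd htr).shift (cellPos c)).density =
      (Fintype.card (Cell m) : ℝ)⁻¹ * ∑ k : Cell m,
        (((nAt (cellPos c + latPt q m k) (cellPos_add_latPt_mem_halfOpenRect q m c k) 0 +
            nAt (cellPos c + latPt q m k) (cellPos_add_latPt_mem_halfOpenRect q m c k) 1) * ρ₀).trace).re := by
  rw [density_shift_perRectTrialState]
  congr 1
  exact Finset.sum_congr rfl fun k _ => density_shift_rectTilingState_eq_trace _ ρ₀ hev hpsd htr _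

/-- **THE CELL FILLING of the trial state**: `cellFilling q ω̃ = |Cell Q|⁻¹ · Re tr(N ρ₀)`. [cite: ArakiMoriya2003, §4.1 (number operators)] -/
theorem cellFilling_perRectTrialState :
    (perRectTrialState q m ρ₀ hev hpsd htr).cellFilling q =
      (Fintype.card (Cell (alignedPeriods q m)) : ℝ)⁻¹ * ((totalNumber : FermionOp (halfOpenRect (alignedPeriods q m))) * ρ₀).trace.re := by
  set ν := rectTilingState (alignedPeriods q m) ρ₀ hev hpsd htr with hν
  rw [InfVolFermionState.cellFilling]
  simp only [density_shift_perRectTrialState, ← hν]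
  rw [← Finset.mul_sum, ← sum_halfOpenRect_aligned_eq_sum_sum q m (fun x => (ν.shift x).density),
    ← sum_cell_eq_sum_halfOpenRect (alignedPeriods q m) (fun x => (ν.shift x).density), hν, sum_cell_density_rectTilingState_eq, ← mul_assoc,
    card_cell_alignedPeriods, Nat.cast_mul, mul_inv]

/-- **The cell mean energy of the trial state is the block average of the site energies of the tiling state** (`Ψ` `q`-periodic):
`|Cell Q| · ē_q(ω̃) = Σ_{x ∈ [0,Q+1)} Re ε_{⊗ρ₀}(x)`. [cite: BratteliRobinsonII1997, Thm. 6.2.40] -/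
theorem card_mul_cellMeanEnergy_perRectTrialState {Ψ : FermionInteraction d} (hΨ : Ψ.IsPeriodic q) (R : ℝ) :
    (Fintype.card (Cell (alignedPeriods q m)) : ℝ) * cellMeanEnergy q Ψ (perRectTrialState q m ρ₀ hev hpsd htr) R =
      ∑ x ∈ halfOpenRect (alignedPeriods q m), (siteEnergy Ψ (rectTilingState (alignedPeriods q m) ρ₀ hev hpsd htr) R x).re := by
  set ν := rectTilingState (alignedPeriods q m) ρ₀ hev hpsd htr with hν
  rw [cellMeanEnergy, sum_halfOpenRect_aligned_eq_sum_sum q m]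
  have hC : (Fintype.card (Cell q) : ℝ) ≠ 0 := Nat.cast_ne_zero.2 Fintype.card_ne_zero
  have hK : (Fintype.card (Cell m) : ℝ) ≠ 0 := Nat.cast_ne_zero.2 Fintype.card_ne_zero
  have hsite : ∀ c : Cell q, (siteEnergy Ψ (perRectTrialState q m ρ₀ hev hpsd htr) R (cellPos c)).re =
      (Fintype.card (Cell m) : ℝ)⁻¹ * ∑ k : Cell m, (siteEnergy Ψ ν R (cellPos c + latPt q m k)).re := by
    intro c
    have hs : ∀ k : Cell m, siteEnergy Ψ (ν.shift (latPt q m k)) R (cellPos c) = siteEnergy Ψ ν R (cellPos c + latPt q m k) :=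
      fun k => by rw [latPt, hΨ.siteEnergy_shift_superlatVec]
    rw [perRectTrialState_def, ← hν, siteEnergy_shiftAverage]
    simp only [hs, Complex.re_ofReal_mul, Complex.re_sum]
  rw [Finset.sum_congr rfl fun c _ => hsite c, ← Finset.mul_sum, ← mul_assoc, ← mul_assoc, card_cell_alignedPeriods, Nat.cast_mul]
  have e : (Fintype.card (Cell q) : ℝ) * (Fintype.card (Cell m) : ℝ) * (Fintype.card (Cell q) : ℝ)⁻¹ * (Fintype.card (Cell m) : ℝ)⁻¹ = 1 := by
    field_simp
  rw [e, one_mul]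

/-- **THE EXACT CELL MEAN ENERGY of the periodic cluster trial state**: for a `q`-periodic `Ψ` of finite range `R` whose terms straddling the block
boundary have zero expectation in `⊗ρ₀` (every hopping-type interaction: odd × odd factors), `ē_q(ω̃) = |Cell Q|⁻¹ · (Re tr(H_{[0,Q+1)} ρ₀) − Re (⊗ρ₀)(Ψ∅))`.
[cite: BratteliRobinsonII1997, Thm. 6.2.40] [cite: Ruelle1969, §3.3] -/
theorem cellMeanEnergy_perRectTrialState_eq {Ψ : FermionInteraction d} (hΨ : Ψ.IsPeriodic q) {R : ℝ} (hR : Ψ.HasFiniteRange R)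
    (hvan : ∀ Y : Finset (Site d), ¬ Y ⊆ halfOpenRect (alignedPeriods q m) → (Y ∩ halfOpenRect (alignedPeriods q m)).Nonempty →
      (rectTilingState (alignedPeriods q m) ρ₀ hev hpsd htr).expect Y (Ψ.Φ Y) = 0) :
    cellMeanEnergy q Ψ (perRectTrialState q m ρ₀ hev hpsd htr) R =
      (Fintype.card (Cell (alignedPeriods q m)) : ℝ)⁻¹ *
        ((Ψ.localHamiltonian (halfOpenRect (alignedPeriods q m)) * ρ₀).trace -
          (rectTilingState (alignedPeriods q m) ρ₀ hev hpsd htr).expect ∅ (Ψ.Φ ∅)).re := by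
  have hQ : (Fintype.card (Cell (alignedPeriods q m)) : ℝ) ≠ 0 := Nat.cast_ne_zero.2 Fintype.card_ne_zero
  have h := card_mul_cellMeanEnergy_perRectTrialState q m ρ₀ hev hpsd htr hΨ R
  rw [← sum_cell_eq_sum_halfOpenRect (alignedPeriods q m) (fun x => (siteEnergy Ψ _ R x).re), ← Complex.re_sum,
    sum_cell_siteEnergy_rectTilingState_eq (alignedPeriods q m) ρ₀ hev hpsd htr hR hvan] at h
  rw [← h, ← mul_assoc, inv_mul_cancel₀ hQ, one_mul]

end Trial

end InfVolFermionState

end Literature.MathematicalPhysics.QuantumLattice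

end
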